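import Summits.KontsevichZagierPeriods.KontsevichZagierPeriods.Theorems.SoloBlindOctaCoverPullback
import Summits.KontsevichZagierPeriods.KontsevichZagierPeriods.Theorems.SoloBlindOcta
import Summits.KontsevichZagierPeriods.KontsevichZagierPeriods.Theorems.SoloBlindTwelveSporadic
import HarnessLib

/-!
# The degree-six cover at level 24: `β(1/24,1/6) ≐ β(1/6,1/2)` inside the rules

With `G`, `θ = λ S E` from `SoloBlindOctaCoverPrep` / `SoloBlindOctaCoverPullback` the moves are,
all on the line:

* split `[(0,1), θ] ≡ [(0,√2-1), θ] + [(√2-1,1), θ]` (domain additivity);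
* two substitutions `t = G(W)`:
  `[(0,√2-1), θ] ≡ [(0,1), t^{-5/6}(1-t)^{-1/2}] ≡ [(√2-1,1), θ]`, so `[(0,1), θ] = 2 β(1/6,1/2)`;
* three integrand-additivity splits `θ = (λs₀/4)·4E + (λs₁/4)·4vE - (λs₂/4)·4v²E - (λ/4)·4v³E`
  into the octahedral transports `R_j = [(0,1), 4v^jE] = β((6j+1)/24, 1/6)` of `SoloBlindOcta`.

Hence the four-term relation (`betaQ_octaCover`)

  `2 • β(1/6,1/2) = (λs₀/4) • β(1/24,1/6) + (λs₁/4) • β(7/24,1/6) - (λs₂/4) • β(13/24,1/6)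
                    - (λ/4) • β(19/24,1/6)`

(numerically `2·7.2859 = 14.5718`), and with the octahedral merge `β(7/24,1/6) ≐ β(1/24,1/6)`
(`betaQ_propTo_octa`) and the two `S₃`-orbit relations at `{4,7,13}` and `{1,4,19}` every term on
the right is a `K₀`-multiple of `β(1/24,1/6)`; the resulting coefficient is nonzero because the
period of the left side is positive.  This gives (`betaQ_propTo_octaCover`)

  `β(1/24,1/6) ≐ β(1/6,1/2)`,

i.e. the orbits `{1,4,19} ~ {4,7,13}` join the Deligne–Koblitz–Ogus class of `{4,8,12}`
(`β(1/6,1/2)`), which by the duplication/triplication/quartic families already contains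
`{8,8,8}`, `{2,8,14}`, `{4,4,16}` and, through the level-12 sporadic cover of
`SoloBlindTwelveSporadic` read at level `24`, also `{4,6,14}`, `{2,4,18}`.  Together with
`SoloBlindOcta` this completes, inside the Kontsevich–Zagier rules, the eight-orbit first-kind
DKO class of `{4,8,12}` at level `24`, which the one-variable Gauss calculus splits into four
pieces.
-/

noncomputable section

open Set MeasureTheory MvPolynomial

namespace Summit.KontsevichZagierPeriods.KontsevichZagierPeriods.Theorems

namespace SoloBlind

open Literature.ModelTheory.ExponentialFields (IsSemialgebraic)
open Literature.NumberTheory.Transcendental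
open Literature.NumberTheory.Transcendental.KZ

/-! ## The representations -/

/-- `Θ = [(0,1), θ]`. -/
def ocThetaRep : IntegralRep 1 :=
  lineRep (Ioo 0 1) ocTheta mix_line_sa sa_ocTheta_unit integrableOn_ocTheta

/-- `Θ_L = [(0,√2-1), θ]`. -/
def ocThetaL : IntegralRep 1 :=
  lineRep (Ioo 0 (r2 - 1)) ocTheta oc_lineL_sa sa_ocTheta_left integrableOn_ocTheta_left

/-- `Θ_R = [(√2-1,1), θ]`. -/
def ocThetaR : IntegralRep 1 :=
  lineRep (Ioo (r2 - 1) 1) ocTheta oc_lineR_sa sa_ocTheta_right integrableOn_ocTheta_right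

/-- `λs₁/4` is algebraic. -/
theorem isAlgebraic_ocL1 : IsAlgebraic ℚ (ocL * ocS1 / 4) :=
  (isAlgebraic_ocL.mul isAlgebraic_ocS1).mul (by simpa using isAlgebraic_rat ℚ (A := ℝ) 4⁻¹)

/-- `-(λs₂/4)` is algebraic. -/
theorem isAlgebraic_ocL2 : IsAlgebraic ℚ (-(ocL * ocS2 / 4)) :=
  ((isAlgebraic_ocL.mul isAlgebraic_ocS2).mul (by simpa using isAlgebraic_rat ℚ (A := ℝ) 4⁻¹)).neg

/-- `-(λ/4)` is algebraic. -/
theorem isAlgebraic_ocL3 : IsAlgebraic ℚ (-(ocL / 4)) :=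
  (isAlgebraic_ocL.mul (by simpa using isAlgebraic_rat ℚ (A := ℝ) 4⁻¹)).neg

/-- `λs₀/4` is algebraic. -/
theorem isAlgebraic_ocL0 : IsAlgebraic ℚ (ocL * ocS0 / 4) :=
  (isAlgebraic_ocL.mul isAlgebraic_ocS0).mul (by simpa using isAlgebraic_rat ℚ (A := ℝ) 4⁻¹)

/-- The integrand of `T₁₂₃` is integrable on `(0,1)`. -/
theorem integrableOn_ocT123 : IntegrableOn (fun v => ocL * ocS1 / 4 * (4 * (v ^ 1 * octE v)) +
    (-(ocL * ocS2 / 4) * (4 * (v ^ 2 * octE v)) + -(ocL / 4) * (4 * (v ^ 3 * octE v))))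
    (Ioo 0 1) :=
  ((integrableOn_octR 1).const_mul (ocL * ocS1 / 4)).add
    (((integrableOn_octR 2).const_mul (-(ocL * ocS2 / 4))).add
      ((integrableOn_octR 3).const_mul (-(ocL / 4))))

/-- The integrand of `T₂₃` is integrable on `(0,1)`. -/
theorem integrableOn_ocT23 : IntegrableOn (fun v => -(ocL * ocS2 / 4) * (4 * (v ^ 2 * octE v)) +
    -(ocL / 4) * (4 * (v ^ 3 * octE v))) (Ioo 0 1) :=
  ((integrableOn_octR 2).const_mul (-(ocL * ocS2 / 4))).add
    ((integrableOn_octR 3).const_mul (-(ocL / 4)))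

/-- The integrand of `T₁₂₃` is `ℚ`-semialgebraic on `(0,1)`. -/
theorem sa_ocT123 : IsSemialgebraicFunOn ℚ (line (Ioo (0:ℝ) 1))
    (fun x : Fin 1 → ℝ => ocL * ocS1 / 4 * (4 * (x 0 ^ 1 * octE (x 0))) +
      (-(ocL * ocS2 / 4) * (4 * (x 0 ^ 2 * octE (x 0))) +
        -(ocL / 4) * (4 * (x 0 ^ 3 * octE (x 0))))) :=
  (IsSemialgebraicFunOn.add_holds (sa_const_poly_octE isAlgebraic_ocL1 (4 * X 0 ^ 1))
    (IsSemialgebraicFunOn.add_holds (sa_const_poly_octE isAlgebraic_ocL2 (4 * X 0 ^ 2))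
      (sa_const_poly_octE isAlgebraic_ocL3 (4 * X 0 ^ 3)))).congr fun x _ => by
    simp only [Pi.add_apply, map_mul, map_pow, map_ofNat, aeval_X]; ring

/-- The integrand of `T₂₃` is `ℚ`-semialgebraic on `(0,1)`. -/
theorem sa_ocT23 : IsSemialgebraicFunOn ℚ (line (Ioo (0:ℝ) 1))
    (fun x : Fin 1 → ℝ => -(ocL * ocS2 / 4) * (4 * (x 0 ^ 2 * octE (x 0))) +
      -(ocL / 4) * (4 * (x 0 ^ 3 * octE (x 0)))) :=
  (IsSemialgebraicFunOn.add_holds (sa_const_poly_octE isAlgebraic_ocL2 (4 * X 0 ^ 2))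
    (sa_const_poly_octE isAlgebraic_ocL3 (4 * X 0 ^ 3))).congr fun x _ => by
    simp only [Pi.add_apply, map_mul, map_pow, map_ofNat, aeval_X]; ring

/-- `T₁₂₃ = [(0,1), (λs₁/4)·4vE + (-(λs₂/4)·4v²E + -(λ/4)·4v³E)]`. -/
def ocT123 : IntegralRep 1 :=
  lineRep (Ioo 0 1) (fun v => ocL * ocS1 / 4 * (4 * (v ^ 1 * octE v)) +
    (-(ocL * ocS2 / 4) * (4 * (v ^ 2 * octE v)) + -(ocL / 4) * (4 * (v ^ 3 * octE v))))
    mix_line_sa sa_ocT123 integrableOn_ocT123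

/-- `T₂₃ = [(0,1), -(λs₂/4)·4v²E + -(λ/4)·4v³E]`. -/
def ocT23 : IntegralRep 1 :=
  lineRep (Ioo 0 1) (fun v => -(ocL * ocS2 / 4) * (4 * (v ^ 2 * octE v)) +
    -(ocL / 4) * (4 * (v ^ 3 * octE v))) mix_line_sa sa_ocT23 integrableOn_ocT23

/-! ## The moves -/

/-- **Move 1:** `Θ ≡ Θ_L + Θ_R` (domain additivity at `√2-1`). -/
theorem ocThetaRep_split : of ocThetaRep - (of ocThetaL + of ocThetaR) ∈ relations := by
  have hP := r2_sub_one_mem.1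
  have hP1 := r2_sub_one_mem.2
  suffices h : of ocThetaRep - ∑ i ∈ (Finset.univ : Finset (Fin 2)),
      of (![ocThetaL, ocThetaR] i) ∈ relations by
    rw [Fin.sum_univ_two, Matrix.cons_val_zero, Matrix.cons_val_one,
      Matrix.cons_val_fin_one] at h
    exact h
  refine of_sub_sum_of_mem_relations (Finset.univ : Finset (Fin 2)) ocThetaRep
    ![ocThetaL, ocThetaR] ?_ ?_ ?_ ?_
  · intro i _
    fin_cases i
    · refine measure_mono_null (fun x hx => ?_) measure_empty
      have h1 : x 0 ∈ Ioo (0:ℝ) (r2 - 1) := hx.1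
      exact hx.2 (show x 0 ∈ Ioo (0:ℝ) 1 from ⟨h1.1, h1.2.trans hP1⟩)
    · refine measure_mono_null (fun x hx => ?_) measure_empty
      have h1 : x 0 ∈ Ioo (r2 - 1) 1 := hx.1
      exact hx.2 (show x 0 ∈ Ioo (0:ℝ) 1 from ⟨hP.trans h1.1, h1.2⟩)
  · intro i _
    fin_cases i <;> exact fun _ _ => rfl
  · have hnull : volume {x : Fin 1 → ℝ | x 0 = r2 - 1} = 0 := by
      rw [volume_pi]
      exact Measure.pi_hyperplane (fun _ : Fin 1 => (volume : Measure ℝ)) 0 (r2 - 1)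
    refine measure_mono_null (fun x hx => ?_) hnull
    have h0 : x 0 ∈ Ioo (0:ℝ) 1 := hx.1
    have hn := hx.2
    simp only [Finset.mem_univ, iUnion_true, mem_iUnion, not_exists] at hn
    by_contra hc
    rcases lt_or_gt_of_ne hc with hlt | hgt
    · exact hn 0 (show x 0 ∈ Ioo (0:ℝ) (r2 - 1) from ⟨h0.1, hlt⟩)
    · exact hn 1 (show x 0 ∈ Ioo (r2 - 1) 1 from ⟨hgt, h0.2⟩)
  · intro i _ j _ hij
    refine measure_mono_null (fun x hx => ?_) measure_empty
    fin_cases i <;> fin_cases j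
    · exact (hij rfl).elim
    · have h1 : x 0 ∈ Ioo (0:ℝ) (r2 - 1) := hx.1
      have h2 : x 0 ∈ Ioo (r2 - 1) 1 := hx.2
      exact (lt_irrefl _ (h1.2.trans h2.1)).elim
    · have h1 : x 0 ∈ Ioo (r2 - 1) 1 := hx.1
      have h2 : x 0 ∈ Ioo (0:ℝ) (r2 - 1) := hx.2
      exact (lt_irrefl _ (h2.2.trans h1.1)).elim
    · exact (hij rfl).elim

/-- **Move 2:** `Θ_L ≡ β(1/6,1/2)` (substitution `t = G(W)` on `(0,√2-1)`). -/
theorem ocThetaL_sub_betaRep :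
    of ocThetaL - of (betaRep (1 / 6) (1 / 2) (by norm_num) (by norm_num)) ∈ relations := by
  unfold ocThetaL betaRep
  exact lineRep_subst ocG ocG' sa_ocG_left
    (fun W hW => (hasDerivAt_ocG hW.1.le (hW.2.trans r2_sub_one_mem.2).le).hasDerivWithinAt)
    injOn_ocG_left image_ocG_left
    (fun W hW => oc_pull ⟨hW.1, hW.2.trans r2_sub_one_mem.2⟩ hW.2.ne)

/-- **Move 3:** `Θ_R ≡ β(1/6,1/2)` (substitution `t = G(W)` on `(√2-1,1)`). -/
theorem ocThetaR_sub_betaRep :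
    of ocThetaR - of (betaRep (1 / 6) (1 / 2) (by norm_num) (by norm_num)) ∈ relations := by
  unfold ocThetaR betaRep
  exact lineRep_subst ocG ocG' sa_ocG_right
    (fun W hW => (hasDerivAt_ocG (r2_sub_one_mem.1.trans hW.1).le hW.2.le).hasDerivWithinAt)
    injOn_ocG_right image_ocG_right
    (fun W hW => oc_pull ⟨r2_sub_one_mem.1.trans hW.1, hW.2⟩ hW.1.ne')

/-- **Move 4:** `Θ ≡ (λs₀/4)·R₀ + T₁₂₃` (integrand additivity). -/
theorem ocThetaRep_sub_sub :
    of ocThetaRep - of ((octR 0).constMul (ocL * ocS0 / 4) isAlgebraic_ocL0) - of ocT123 ∈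
      relations :=
  of_sub_sub_mem_relations_of_add rfl rfl fun x _ => by
    simp only [ocThetaRep, octR, ocT123, lineRep_integrand, IntegralRep.integrand_constMul,
      ocTheta, ocS]
    ring

/-- **Move 5:** `T₁₂₃ ≡ (λs₁/4)·R₁ + T₂₃`. -/
theorem ocT123_sub_sub :
    of ocT123 - of ((octR 1).constMul (ocL * ocS1 / 4) isAlgebraic_ocL1) - of ocT23 ∈
      relations :=
  of_sub_sub_mem_relations_of_add rfl rfl fun x _ => by
    simp only [octR, ocT123, ocT23, lineRep_integrand, IntegralRep.integrand_constMul]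

/-- **Move 6:** `T₂₃ ≡ -(λs₂/4)·R₂ + (-(λ/4))·R₃`. -/
theorem ocT23_sub_sub :
    of ocT23 - of ((octR 2).constMul (-(ocL * ocS2 / 4)) isAlgebraic_ocL2) -
      of ((octR 3).constMul (-(ocL / 4)) isAlgebraic_ocL3) ∈ relations :=
  of_sub_sub_mem_relations_of_add rfl rfl fun x _ => by
    simp only [octR, ocT23, lineRep_integrand, IntegralRep.integrand_constMul]

/-! ## In `Q` -/

/-- The four coefficients as elements of `K₀`. -/
def ocK (j : Fin 4) : K₀ :=
  ⟨![ocL * ocS0 / 4, ocL * ocS1 / 4, -(ocL * ocS2 / 4), -(ocL / 4)] j, mem_K₀_iff.mpr (by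
    fin_cases j
    · exact isAlgebraic_ocL0
    · exact isAlgebraic_ocL1
    · exact isAlgebraic_ocL2
    · exact isAlgebraic_ocL3)⟩

/-- `(k₀ : ℝ) = λs₀/4`. -/
@[simp] theorem coe_ocK_zero : ((ocK 0 : K₀) : ℝ) = ocL * ocS0 / 4 := rfl

/-- `(k₁ : ℝ) = λs₁/4`. -/
@[simp] theorem coe_ocK_one : ((ocK 1 : K₀) : ℝ) = ocL * ocS1 / 4 := rfl

/-- `(k₂ : ℝ) = -λs₂/4`. -/
@[simp] theorem coe_ocK_two : ((ocK 2 : K₀) : ℝ) = -(ocL * ocS2 / 4) := rfl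

/-- `(k₃ : ℝ) = -λ/4`. -/
@[simp] theorem coe_ocK_three : ((ocK 3 : K₀) : ℝ) = -(ocL / 4) := rfl

/-- `[Θ_L] = β(1/6,1/2)`. -/
theorem ocThetaL_eq : mkQ (of ocThetaL) = betaQ (1 / 6) (1 / 2) := by
  rw [betaQ_eq (by norm_num : (0:ℚ) < 1 / 6) (by norm_num : (0:ℚ) < 1 / 2)]
  exact mkQ_eq_mkQ_iff.mpr ocThetaL_sub_betaRep

/-- `[Θ_R] = β(1/6,1/2)`. -/
theorem ocThetaR_eq : mkQ (of ocThetaR) = betaQ (1 / 6) (1 / 2) := by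
  rw [betaQ_eq (by norm_num : (0:ℚ) < 1 / 6) (by norm_num : (0:ℚ) < 1 / 2)]
  exact mkQ_eq_mkQ_iff.mpr ocThetaR_sub_betaRep

/-- `[Θ] = 2 • β(1/6,1/2)`. -/
theorem ocThetaRep_eq : mkQ (of ocThetaRep) = (2 : K₀) • betaQ (1 / 6) (1 / 2) := by
  have h : mkQ (of ocThetaRep) = mkQ (of ocThetaL) + mkQ (of ocThetaR) := by
    rw [← map_add, mkQ_eq_mkQ_iff]
    exact ocThetaRep_split
  rw [h, ocThetaL_eq, ocThetaR_eq, two_smul]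

/-- `[a·R_j] = a • β(a_j, 1/6)`. -/
theorem octR_constMul_eq' (j : ℕ) {a : ℝ} (ha : IsAlgebraic ℚ a) :
    mkQ (of ((octR j).constMul a ha)) = (⟨a, mem_K₀_iff.mpr ha⟩ : K₀) • betaQ (octA j) (1 / 6) := by
  rw [mkQ_constMul, octR_eq]

/-- **The cover relation** inside the Kontsevich–Zagier rules:
`2 • β(1/6,1/2) = (λs₀/4) • β(1/24,1/6) + (λs₁/4) • β(7/24,1/6) + (-(λs₂/4)) • β(13/24,1/6)
+ (-(λ/4)) • β(19/24,1/6)`. -/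
theorem betaQ_octaCover : (2 : K₀) • betaQ (1 / 6) (1 / 2) = ocK 0 • betaQ (1 / 24) (1 / 6) +
    (ocK 1 • betaQ (7 / 24) (1 / 6) + (ocK 2 • betaQ (13 / 24) (1 / 6) +
      ocK 3 • betaQ (19 / 24) (1 / 6))) := by
  have a0 : octA 0 = 1 / 24 := by unfold octA; norm_num
  have a1 : octA 1 = 7 / 24 := by unfold octA; norm_num
  have a2 : octA 2 = 13 / 24 := by unfold octA; norm_num
  have a3 : octA 3 = 19 / 24 := by unfold octA; norm_num
  have h1 := ocThetaRep_eq
  have h2 : mkQ (of ocThetaRep) = mkQ (of ((octR 0).constMul (ocL * ocS0 / 4) isAlgebraic_ocL0)) +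
      mkQ (of ocT123) := by
    rw [← map_add, mkQ_eq_mkQ_iff]
    have h := ocThetaRep_sub_sub
    rwa [sub_sub] at h
  have h3 : mkQ (of ocT123) = mkQ (of ((octR 1).constMul (ocL * ocS1 / 4) isAlgebraic_ocL1)) +
      mkQ (of ocT23) := by
    rw [← map_add, mkQ_eq_mkQ_iff]
    have h := ocT123_sub_sub
    rwa [sub_sub] at h
  have h4 : mkQ (of ocT23) = mkQ (of ((octR 2).constMul (-(ocL * ocS2 / 4)) isAlgebraic_ocL2)) +
      mkQ (of ((octR 3).constMul (-(ocL / 4)) isAlgebraic_ocL3)) := by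
    rw [← map_add, mkQ_eq_mkQ_iff]
    have h := ocT23_sub_sub
    rwa [sub_sub] at h
  rw [h2, h3, h4, octR_constMul_eq', octR_constMul_eq', octR_constMul_eq', octR_constMul_eq',
    a0, a1, a2, a3] at h1
  exact h1.symm

/-- Period check: `2 B(1/6,1/2) = (λ/4)(s₀B(1/24,1/6) + s₁B(7/24,1/6) - s₂B(13/24,1/6)
- B(19/24,1/6))` (numerically both sides are `14.5718…`). -/
theorem beta_octaCover_value :
    2 * evalQ (betaQ (1 / 6) (1 / 2)) = ocL * ocS0 / 4 * evalQ (betaQ (1 / 24) (1 / 6)) +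
      (ocL * ocS1 / 4 * evalQ (betaQ (7 / 24) (1 / 6)) +
        (-(ocL * ocS2 / 4) * evalQ (betaQ (13 / 24) (1 / 6)) +
          -(ocL / 4) * evalQ (betaQ (19 / 24) (1 / 6)))) := by
  have h := congrArg evalQ betaQ_octaCover
  rw [map_add, map_add, map_add, evalQ_smul, evalQ_smul, evalQ_smul, evalQ_smul, evalQ_smul,
    coe_ocK_zero, coe_ocK_one, coe_ocK_two, coe_ocK_three] at h
  simpa using h

/-! ## The merge -/

/-- The period of `β(a,b)` is positive. -/
theorem evalQ_betaQ_pos {a b : ℚ} (ha : 0 < a) (hb : 0 < b) : 0 < evalQ (betaQ a b) := by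
  rw [evalQ_betaQ ha hb]
  have ha' : (0:ℝ) < a := by exact_mod_cast ha
  have hb' : (0:ℝ) < b := by exact_mod_cast hb
  exact div_pos (mul_pos (Real.Gamma_pos_of_pos ha') (Real.Gamma_pos_of_pos hb'))
    (Real.Gamma_pos_of_pos (by exact_mod_cast add_pos ha hb))

/-- **The cover merge at level 24: `β(1/24,1/6) ≐ β(1/6,1/2)`** — the orbits `{1,4,19} ~ {4,7,13}`
join the Deligne–Koblitz–Ogus class of `{4,8,12}` inside the Kontsevich–Zagier rules. -/
theorem betaQ_propTo_octaCover : PropTo (betaQ (1 / 24) (1 / 6)) (betaQ (1 / 6) (1 / 2)) := by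
  obtain ⟨l, hl0, hl⟩ := betaQ_propTo_octa
  have key := betaQ_octaCover
  have h19 := (betaQ_orbit (19 / 24) (1 / 24) (1 / 6) (by norm_num) (by norm_num) (by norm_num)
    (by norm_num)).1
  have h13 := (betaQ_orbit (13 / 24) (7 / 24) (1 / 6) (by norm_num) (by norm_num) (by norm_num)
    (by norm_num)).1
  -- eliminate `β(7/24,·)`, `β(13/24,·)`, `β(19/24,·)`
  have hrel : (sinQ (13 / 24) * sinQ (19 / 24) * ocK 0 +
      sinQ (13 / 24) * sinQ (19 / 24) * ocK 1 * l + sinQ (19 / 24) * ocK 2 * sinQ (7 / 24) * l +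
      sinQ (13 / 24) * ocK 3 * sinQ (1 / 24)) • betaQ (1 / 24) (1 / 6) =
      (sinQ (13 / 24) * sinQ (19 / 24) * 2) • betaQ (1 / 6) (1 / 2) := by
    linear_combination (norm := module) (-(sinQ (13 / 24) * sinQ (19 / 24))) • key
      - (sinQ (13 / 24) * sinQ (19 / 24) * ocK 1 + sinQ (19 / 24) * ocK 2 * sinQ (7 / 24)) • hl
      - (sinQ (19 / 24) * ocK 2) • h13 - (sinQ (13 / 24) * ocK 3) • h19
  -- the right coefficient is positive, hence so is the left one
  have hs13 := sinQ_coe_pos (show (0:ℚ) < 13 / 24 by norm_num) (by norm_num)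
  have hs19 := sinQ_coe_pos (show (0:ℚ) < 19 / 24 by norm_num) (by norm_num)
  have h2σ : (0:ℝ) < ((sinQ (13 / 24) * sinQ (19 / 24) * 2 : K₀) : ℝ) := by
    push_cast; exact mul_pos (mul_pos hs13 hs19) two_pos
  have hD : sinQ (13 / 24) * sinQ (19 / 24) * 2 ≠ 0 := K₀_ne_zero_of_pos h2σ
  have hBU := evalQ_betaQ_pos (show (0:ℚ) < 1 / 24 by norm_num) (show (0:ℚ) < 1 / 6 by norm_num)
  have hBT := evalQ_betaQ_pos (show (0:ℚ) < 1 / 6 by norm_num) (show (0:ℚ) < 1 / 2 by norm_num)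
  have hM : sinQ (13 / 24) * sinQ (19 / 24) * ocK 0 +
      sinQ (13 / 24) * sinQ (19 / 24) * ocK 1 * l + sinQ (19 / 24) * ocK 2 * sinQ (7 / 24) * l +
      sinQ (13 / 24) * ocK 3 * sinQ (1 / 24) ≠ 0 := by
    intro h0
    have h := congrArg evalQ hrel
    rw [h0, zero_smul, map_zero, evalQ_smul] at h
    have : (0:ℝ) < ((sinQ (13 / 24) * sinQ (19 / 24) * 2 : K₀) : ℝ) *
        evalQ (betaQ (1 / 6) (1 / 2)) := mul_pos h2σ hBT
    linarith
  exact PropTo.of_smul_eq_smul hM hD hrel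

/-- The merge read in the other direction: `β(1/6,1/2) ≐ β(1/24,1/6)`. -/
theorem betaQ_propTo_octaCover' : PropTo (betaQ (1 / 6) (1 / 2)) (betaQ (1 / 24) (1 / 6)) :=
  betaQ_propTo_octaCover.symm

/-- And with the octahedral involution: `β(7/24,1/6) ≐ β(1/6,1/2)`. -/
theorem betaQ_propTo_octaCover'' : PropTo (betaQ (7 / 24) (1 / 6)) (betaQ (1 / 6) (1 / 2)) :=
  betaQ_propTo_octa.trans betaQ_propTo_octaCover

end SoloBlind

end Summit.KontsevichZagierPeriods.KontsevichZagierPeriods.Theorems
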